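import Summits.Ventures.PercRepro.S1CoreStar

/-!
# PercRepro — LEMMA T4⁺: the 4-circuit count of the e-free core, `s₄ ≤ Σ_{j ≤ ν} Σ_{i ≤ j} ⌊3i/2⌋` (p1, gen 21)

`proofs/P1-S4-PERPOINT.md` §6. The T-chain's deletion recursion for 4-circuits (`S1CoreSplit`): deleting a point `e`
of a 4-circuit keeps the core (`hfree_delete`) and lowers the nullity by one; the 4-circuits through `e` number at
most `perPointBound ν = Σ_{i ≤ ν} ⌊3i/2⌋` (`S1CoreStar`). Hence `s₄ ≤ fourCircuitBound ν := Σ_{j ≤ ν} perPointBound j`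
`= 1, 5, 13, 27, 48, 78, 118, 170, 235, 315` at `ν = 1 … 10` (LEMMA T4: `2, 8, 20, 40, 70, 112, 168, 240, 330, 440`),
and in closed form `4·s₄ ≤ ν(ν + 1)(ν + 2)`.
* **`ncard_fourCircuits_le_fourCircuitBound`** — the recursive form;
* **`four_mul_ncard_fourCircuits_le`** — `4·s₄ ≤ d(d + 1)(d + 2)`;
* `fourCircuitBound_six` etc. — the evaluated instances `48, 78, 118, 170` at `ν = 5, 6, 7, 8`.
Axioms: standard.
-/

open scoped Matroid

namespace PercRepro

namespace S1

open Set

variable {α : Type}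

/-- `Σ_{j ≤ d} perPointBound j` (`= 1, 5, 13, 27, 48, 78, 118, 170, 235, 315` at `d = 1 … 10`). -/
def fourCircuitBound (d : ℕ) : ℕ := (Finset.range (d + 1)).sum perPointBound

/-- The recursion `fourCircuitBound (d + 1) = fourCircuitBound d + perPointBound (d + 1)`. -/
theorem fourCircuitBound_succ (d : ℕ) : fourCircuitBound (d + 1) = fourCircuitBound d + perPointBound (d + 1) := by
  unfold fourCircuitBound
  rw [Finset.sum_range_succ]

/-- **LEMMA T4⁺, recursive form**: `s₄ ≤ Σ_{j ≤ d} Σ_{i ≤ j} ⌊3i/2⌋` on the e-free core of nullity `d`. -/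
theorem ncard_fourCircuits_le_fourCircuitBound (M : Matroid α) [M.Finite]
    (hfree : ∀ e ∈ M.E, ∃ A ⊆ M.E \ {e}, e ∉ M.closure A ∧ e ∉ M.closure ((M.E \ {e}) \ A))
    {d : ℕ} (hd : M.E.encard = M.eRank + d) :
    {C : Set α | M.IsCircuit C ∧ C.ncard = 4}.ncard ≤ fourCircuitBound d := by
  suffices H : ∀ n : ℕ, ∀ (M : Matroid α) [M.Finite], M.E.ncard = n →
      (∀ e ∈ M.E, ∃ A ⊆ M.E \ {e}, e ∉ M.closure A ∧ e ∉ M.closure ((M.E \ {e}) \ A)) →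
      ∀ d : ℕ, M.E.encard = M.eRank + d →
      {C : Set α | M.IsCircuit C ∧ C.ncard = 4}.ncard ≤ fourCircuitBound d from H _ M rfl hfree d hd
  intro n
  induction n using Nat.strong_induction_on with
  | _ n ih =>
  intro M _ hn hfree d hd
  classical
  set S := {C : Set α | M.IsCircuit C ∧ C.ncard = 4} with hS
  have hSfin : S.Finite :=
    M.ground_finite.finite_subsets.subset (fun C hC => hC.1.subset_ground)
  by_cases hSe : S = ∅
  · rw [hSe, ncard_empty]; exact Nat.zero_le _
  obtain ⟨C₀, hC₀⟩ := nonempty_iff_ne_empty.2 hSe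
  obtain ⟨e, heC₀⟩ := hC₀.1.nonempty
  have heE : e ∈ M.E := hC₀.1.subset_ground heC₀
  have hne : ¬ M.IsColoop e := hC₀.1.not_isColoop_of_mem heC₀
  have hν : M✶.eRank = (d : ℕ∞) := by
    have h := _root_.Matroid.eRank_add_eRank_dual M
    rw [hd] at h
    exact WithTop.add_left_cancel (PercRepro.Matroid.eRank_ne_top_of_finite M) h
  have hdel := PercRepro.Matroid.dual_eRank_delete_singleton_add_one heE hne
  rw [hν] at hdel
  have hfin' : (M ＼ {e})✶.eRank ≠ ⊤ := by
    intro h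
    rw [h] at hdel
    exact absurd hdel (by simp)
  obtain ⟨d', hd'⟩ := ENat.ne_top_iff_exists.1 hfin'
  have hdd' : d = d' + 1 := by
    rw [← hd'] at hdel
    exact_mod_cast hdel.symm
  have hd'enc : (M ＼ {e}).E.encard = (M ＼ {e}).eRank + d' := by
    have h := _root_.Matroid.eRank_add_eRank_dual (M ＼ {e})
    rw [← hd'] at h
    exact h.symm
  have hdelE : (M ＼ {e}).E.ncard < n := by
    rw [_root_.Matroid.delete_ground, ← hn, ← ncard_sdiff_singleton_add_one heE M.ground_finite]
    omega
  have hfree' := hfree_delete M hfree e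
  have hsplit := ncard_fourCircuits_le_through_add_delete M e
  rw [← hS] at hsplit
  have h1 := ncard_fourCircuitsThrough_le_perPointBound M hfree hd e
  have h2 := ih _ hdelE (M ＼ {e}) rfl hfree' d' hd'enc
  subst hdd'
  rw [fourCircuitBound_succ]
  omega

/-- `4·fourCircuitBound d ≤ d(d + 1)(d + 2)`. -/
theorem four_mul_fourCircuitBound_le (d : ℕ) : 4 * fourCircuitBound d ≤ d * (d + 1) * (d + 2) := by
  induction d with
  | zero => simp [fourCircuitBound, perPointBound]
  | succ k ih =>
    rw [fourCircuitBound_succ]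
    have := four_mul_perPointBound_le (k + 1)
    nlinarith

/-- **LEMMA T4⁺, closed form**: `4·s₄ ≤ d(d + 1)(d + 2)` on the e-free core of nullity `d` — three quarters of
LEMMA T4's `3·s₄ ≤ d(d + 1)(d + 2)`. -/
theorem four_mul_ncard_fourCircuits_le (M : Matroid α) [M.Finite]
    (hfree : ∀ e ∈ M.E, ∃ A ⊆ M.E \ {e}, e ∉ M.closure A ∧ e ∉ M.closure ((M.E \ {e}) \ A))
    {d : ℕ} (hd : M.E.encard = M.eRank + d) :
    4 * {C : Set α | M.IsCircuit C ∧ C.ncard = 4}.ncard ≤ d * (d + 1) * (d + 2) :=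
  (Nat.mul_le_mul_left 4 (ncard_fourCircuits_le_fourCircuitBound M hfree hd)).trans
    (four_mul_fourCircuitBound_le d)

/-- The evaluated instance `fourCircuitBound 5 = 48`. -/
theorem fourCircuitBound_five : fourCircuitBound 5 = 48 := by decide

/-- The evaluated instance `fourCircuitBound 6 = 78`. -/
theorem fourCircuitBound_six : fourCircuitBound 6 = 78 := by decide

/-- The evaluated instance `fourCircuitBound 7 = 118`. -/
theorem fourCircuitBound_seven : fourCircuitBound 7 = 118 := by decide

/-- The evaluated instance `fourCircuitBound 8 = 170`. -/
theorem fourCircuitBound_eight : fourCircuitBound 8 = 170 := by decide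

/-- The perPointBound instances `1, 4, 8, 14, 21, 30` at `d = 1 … 6`. -/
theorem perPointBound_six : perPointBound 6 = 30 := by decide

end S1

end PercRepro
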